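import Summits.QuantumFields.BalabanUV.Beta.RemainderExplicitHistoryJunction

/-!
# RemainderExplicitConsumedShape — road P3 at the ROW OWNER's (D4-J4) «two shapes»: the junction inputs RE-PRICED for binder (D4)
# AS CONSUMED — bounded diagonal remainder `< b` and bounded history oscillation `< 2b` on ONE box are NECESSARY, bounded inputs
# with `d + o < b` are SUFFICIENT, both thresholds are ATTAINED by the row's own toy families; road P3's END delivers `(r⋆, 2r⋆)`

Cell `pub-balaban`, β-function sub-cell, BINDER row D4 «RemainderConst leaves for Bałaban's split» (`HOME/BINDER-OWNERS.md`, owner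
lineage `b2b-balaban-beta-an4`); this file by the row's co-owner #3 lineage `b2b-balaban-beta-d4-p3` (ROAD P3 = the reduction road,
series `Summits/QuantumFields/BalabanUV/Beta/RemainderExplicit*.lean`; skeleton `HOME/beta/skeletons/D4-b2b-balaban-beta-d4-p3.md`),
generation 31, β-FLOW TEAM duty (1) under the coordinator rulings «YM REDIRECT TOWARDS THE SUMMIT» (FREEZE (0) honoured: a def-free
module in road P3's own series; no leaf, no interface, no folklore-algebra module) and «YM ACCELERATION».  It answers, from road P3's
side, the item the ROW OWNER located today in (D4-J4) `RemainderConstTwoShapes` (beta-an4 generation 61): binder (D4) AS CONSUMED is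
«ONE remainder constant `r < b` on ONE box ]0,γ₀]^{k+1}» (CONSUMED(b)), not the JUNCTION «∀ b > 0 ∃ γ₁ …»; the junction's exact price is
(DIAG) ∧ (OSC) — the diagonal MODULUS and the VANISHING oscillation ((D4-J2) `remainderConst_small_iff_diag_and_osc`) — and that price
is NOT necessary for CONSUMED.  This module says what the two junction inputs BECOME in the consumed currency.

HONEST FRAMING (BETA-SPEC §0.2, verbatim and binding). *"Discharging BetaPertH makes Bałaban's UV stability UNCONDITIONAL — a
real constructive-QFT result; it is NOT the continuum limit and NOT the Clay problem."*  THIS MODULE DISCHARGES NOTHING: elementary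
real analysis on the tree's typed shapes `FlowStep.HBeta`, `B12Beta.OneLoopSplit` ([I] (2.12)–(2.14) p. 268), `RemainderChain.RemainderConst`,
plus by-name use of road P3's END; nothing of Bałaban's (1.22) is asserted, constructed or instantiated; row D4 class UNCHANGED
(critical-path width 0: THE INSTANCE over NODE O.2 absent; instance 0∕1; D4 DISCHARGE NO DATE).  NOT BetaPertH, NOT continuum,
NOT Clay.  HONEST DEPENDENCY: continuum YM on T⁴ ⇐ BetaPertH ∧ nine spine estimates (0/9 proved); BetaPertH ⇐ (D1) ∧ (D4) ∧
CAP+tail; G-an2-4 gates asym, D1 and NE2/3/4.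

THE SHAPES (spelled inline; 0 `def`).  CONSUMED(b): «∃ γ₀ > 0 ∃ r, 0 ≤ r ∧ r < b ∧ RemainderConst S γ₀ r» ((D4-J4)'s spelling; the
consumers `DriftRemainder.endpointExistence_of_drift_remainderConst`, `ConstRemainderConsumers.flowControl_along_of_driftRemainderConst`).
BOUNDED DIAGONAL(γ, d): «∀ k g, 0 < g ≤ γ → |β¹_{k+1}(g,…,g)| ≤ d».  BOUNDED OSCILLATION(γ, o): «∀ k, ∀ p ∈ ]0,γ]^{k+1},
|β_{k+1}(p) − β_{k+1}(p_k,…,p_k)| ≤ o» (split-free: the one-loop part cancels).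

WHAT IS PROVED ([folklore]; 0 sorry; 0 `def`).
* §1 NECESSITY `boundedInputs_of_consumed`: CONSUMED(b) ⟹ on the same box BOUNDED DIAGONAL(γ₀, r) ∧ BOUNDED OSCILLATION(γ₀, 2r) with
  `r < b` — bounded inputs at thresholds `b` and `2b`, NOT moduli.
* §2 SUFFICIENCY `remainderConst_of_diag_osc` ∕ `consumed_of_diag_osc`: BOUNDED DIAGONAL(γ, d) ∧ BOUNDED OSCILLATION(γ, o) ⟹
  `RemainderConst S γ (d + o)`; hence CONSUMED(b) as soon as `d + o < b` (γ > 0).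
* §3 BOTH THRESHOLDS ARE ATTAINED by the row's existing toy families: `sufficiency_threshold_attained` — (E11)'s history family
  `β = M·h(p_k∕p_0)` (co-owner #2's `EriceRemainderEnclosureDiagonal`): diagonal remainder ≡ 0 (d = 0), oscillation ≤ M (o = M) on
  every box, and CONSUMED(b) ⟺ `M < b` — so `d + o < b` cannot be relaxed to `≤`; `necessity_factor_two_attained` — the (D4-J3)
  perturbation of the JUMP datum (road P3's §4 of `RemainderExplicitHistoryJunction`): CONSUMED(b) ⟺ `M∕2 < b` while on EVERY box
  the oscillation reaches `M` — so §1's `2r` (oscillation `< 2b`) cannot be sharpened.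
* §4 `roadP3_consumed`: road P3's END (`RemainderExplicitEnd.exists_remainderConst_of_residualChain`, one γ-independent constant
  `r⋆ = ε₁·remCoeffL 4 Mc c α₂ B₃` on the residual chain's box) delivers CONSUMED(b) for every `b > r⋆` together with the bounded
  inputs `(r⋆, 2r⋆)` — the consumed currency of `RemainderExplicitHistoryJunction.roadP3_at_junction`.
* END `consumedShape_census`.
READING (for CITATION-FIT §2 (α) ∕ SPINE S-D4 «junction inputs», beside (D4-J4)): for binder (D4) AS CONSUMED at the drift's `b`
the two junction inputs are due in BOUNDED form on ONE box — diagonal remainder `< b`, history oscillation `< 2b` (necessary;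
`d + o < b` sufficient; constants sharp) — not as moduli at g² = 0; road P3's explicit residual (R) at small ε₁ supplies exactly that,
given THE INSTANCE (0∕1).  Class UNCHANGED.
-/

noncomputable section

open Filter
open Literature.MathematicalPhysics.QuantumFieldTheory.Balaban1983to89
open Literature.MathematicalPhysics.QuantumFieldTheory.Balaban1983to89.Beta
open Literature.MathematicalPhysics.QuantumFieldTheory.Balaban1983to89.FlowStep (HBeta)
open Literature.MathematicalPhysics.QuantumFieldTheory.Balaban1983to89.Beta.RemainderChain (RemainderConst)
open Literature.MathematicalPhysics.QuantumFieldTheory.Balaban1983to89.Beta.RemainderChainLattice (CondsL remCoeffL)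
open Literature.MathematicalPhysics.QuantumFieldTheory.Balaban1983to89.Beta.RemainderConstCertified (remainderConst_nonneg)
open Summit.QuantumFields.BalabanUV.Beta.RemainderExplicitRoad (ResidualChain)
open Summit.QuantumFields.BalabanUV.Beta.RemainderExplicitEnd (carrierFamily exists_remainderConst_of_residualChain)
open Summit.QuantumFields.BalabanUV.Beta.EriceRemainderEnclosureHistoryJunction (sub_eq_β1_sub)
open Summit.QuantumFields.BalabanUV.Beta.RemainderExplicitHistoryJunction (osc_le_of_remainderConst twoLevel_last
  remainderConst_jump remainderConst_jump_iff)

namespace Summit.QuantumFields.BalabanUV.Beta.RemainderExplicitConsumedShape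

variable {β : HBeta}

/-! ## §1 Necessity: (D4) as consumed forces BOUNDED junction inputs on its box — diagonal remainder `≤ r < b`, oscillation `≤ 2r < 2b` -/

/-- One remainder constant bounds the DIAGONAL remainder on its box (the constant history `(g,…,g)`, `0 < g ≤ γ`, lies in
]0,γ]^{k+1}). [folklore] -/
theorem diag_le_of_remainderConst (S : B12Beta.OneLoopSplit β) {γ r : ℝ} (h : RemainderConst S γ r) (k : ℕ) {g : ℝ}
    (hg : 0 < g) (hgγ : g ≤ γ) : |S.β1 k (fun _ : Fin (k + 1) => g)| ≤ r :=
  h k _ fun _ => ⟨hg, hgγ⟩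

/-- **NECESSITY.**  CONSUMED(b) ⟹ on the SAME box: BOUNDED DIAGONAL(γ₀, r) and BOUNDED OSCILLATION(γ₀, 2r) with `0 ≤ r < b` — the
junction inputs (DIAG) ∧ (OSC) of (D4-J2) in BOUNDED form at the thresholds `b` and `2b`; no modulus at g² = 0 is forced. [folklore] -/
theorem boundedInputs_of_consumed (S : B12Beta.OneLoopSplit β) {b : ℝ}
    (hC : ∃ γ₀ : ℝ, 0 < γ₀ ∧ ∃ r : ℝ, 0 ≤ r ∧ r < b ∧ RemainderConst S γ₀ r) :
    ∃ γ₀ : ℝ, 0 < γ₀ ∧ ∃ r : ℝ, 0 ≤ r ∧ r < b ∧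
      (∀ (k : ℕ) (g : ℝ), 0 < g → g ≤ γ₀ → |S.β1 k (fun _ : Fin (k + 1) => g)| ≤ r) ∧
      (∀ (k : ℕ) (p : Fin (k + 1) → ℝ), p ∈ B12Beta.HistBox γ₀ k →
        |β k p - β k (fun _ : Fin (k + 1) => p (Fin.last k))| ≤ 2 * r) := by
  obtain ⟨γ₀, hγ₀, r, hr0, hrb, hR⟩ := hC
  exact ⟨γ₀, hγ₀, r, hr0, hrb, fun k _ hg hgγ => diag_le_of_remainderConst S hR k hg hgγ,
    fun k _ hp => osc_le_of_remainderConst S hR k hp⟩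

/-! ## §2 Sufficiency: bounded inputs `d`, `o` on one box with `d + o < b` give (D4) as consumed -/

/-- **BOUNDED DIAGONAL + BOUNDED OSCILLATION ⟹ ONE REMAINDER CONSTANT `d + o`** on the same box (`β¹(p) = β¹(p_k,…,p_k) +
(β(p) − β(p_k,…,p_k))`, the one-loop part cancelling in the difference). [folklore] -/
theorem remainderConst_of_diag_osc (S : B12Beta.OneLoopSplit β) {γ d o : ℝ}
    (hd : ∀ (k : ℕ) (g : ℝ), 0 < g → g ≤ γ → |S.β1 k (fun _ : Fin (k + 1) => g)| ≤ d)
    (ho : ∀ (k : ℕ) (p : Fin (k + 1) → ℝ), p ∈ B12Beta.HistBox γ k →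
      |β k p - β k (fun _ : Fin (k + 1) => p (Fin.last k))| ≤ o) :
    RemainderConst S γ (d + o) := by
  intro k p hp
  have h1 := hd k (p (Fin.last k)) (hp (Fin.last k)).1 (hp (Fin.last k)).2
  have h2 := ho k p hp
  rw [sub_eq_β1_sub S] at h2
  rw [abs_le] at h1 h2 ⊢
  constructor <;> linarith [h1.1, h1.2, h2.1, h2.2]

/-- **SUFFICIENCY.**  BOUNDED DIAGONAL(γ, d) ∧ BOUNDED OSCILLATION(γ, o) on a box `γ > 0` with `d + o < b` ⟹ CONSUMED(b)
(`r = d + o`; `0 ≤ r` by `RemainderConstCertified.remainderConst_nonneg`). [folklore] -/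
theorem consumed_of_diag_osc (S : B12Beta.OneLoopSplit β) {γ d o b : ℝ} (hγ : 0 < γ)
    (hd : ∀ (k : ℕ) (g : ℝ), 0 < g → g ≤ γ → |S.β1 k (fun _ : Fin (k + 1) => g)| ≤ d)
    (ho : ∀ (k : ℕ) (p : Fin (k + 1) → ℝ), p ∈ B12Beta.HistBox γ k →
      |β k p - β k (fun _ : Fin (k + 1) => p (Fin.last k))| ≤ o)
    (hb : d + o < b) :
    ∃ γ₀ : ℝ, 0 < γ₀ ∧ ∃ r : ℝ, 0 ≤ r ∧ r < b ∧ RemainderConst S γ₀ r :=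
  have hR := remainderConst_of_diag_osc S hd ho
  ⟨γ, hγ, d + o, remainderConst_nonneg S hγ hR, hb, hR⟩

/-! ## §3 Both thresholds are attained (the row's existing toy families) -/

/-- **`d + o < b` IS SHARP** — (E11)'s HISTORY family `β k p = M·h(p_k ∕ p_0)` (`M > 0`; co-owner #2's
`EriceRemainderEnclosureDiagonal`, one-loop part 0): its diagonal remainder is IDENTICALLY 0 (d = 0), its oscillation is `≤ M` on EVERY
box (o = M), and CONSUMED(b) ⟺ `M < b` (`remainderConst_iff_le`) — CONSUMED fails at `b = d + o`. [folklore] -/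
theorem sufficiency_threshold_attained {M : ℝ} (hM : 0 < M) :
    ∃ (β : HBeta) (S : B12Beta.OneLoopSplit β),
      (∀ (k : ℕ) (g : ℝ), S.β1 k (fun _ : Fin (k + 1) => g) = 0) ∧
      (∀ (γ : ℝ) (k : ℕ) (p : Fin (k + 1) → ℝ), p ∈ B12Beta.HistBox γ k →
        |β k p - β k (fun _ : Fin (k + 1) => p (Fin.last k))| ≤ M) ∧
      ∀ b : ℝ, (∃ γ₀ : ℝ, 0 < γ₀ ∧ ∃ r : ℝ, 0 ≤ r ∧ r < b ∧ RemainderConst S γ₀ r) ↔ M < b := by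
  have hβ : ∀ (k : ℕ) (p : Fin (k + 1) → ℝ),
      (fun (k : ℕ) (p : Fin (k + 1) → ℝ) =>
        (0 : ℝ) + M * max 0 (min 1 (4 * (p (Fin.last k) / p 0) * (1 - p (Fin.last k) / p 0)))) k p =
      (0 : ℝ) + M * max 0 (min 1 (4 * (p (Fin.last k) / p 0) * (1 - p (Fin.last k) / p 0))) := fun _ _ => rfl
  obtain ⟨S, hS⟩ := EriceRemainderEnclosureDiagonal.exists_split hβ
  refine ⟨_, S, fun k g => EriceRemainderEnclosureDiagonal.β1_constHistory hβ S hS g k, fun γ k p _ => ?_,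
    fun b => ⟨?_, fun hb => ?_⟩⟩
  · have e := sub_eq_β1_sub S k p (fun _ => p (Fin.last k))
    have hz := EriceRemainderEnclosureDiagonal.β1_constHistory hβ S hS (p (Fin.last k)) k
    have hb' := abs_le.mp (EriceRemainderEnclosureDiagonal.abs_β1_le hβ hM.le S hS k p)
    rw [abs_le]; constructor <;> linarith [hb'.1, hb'.2]
  · rintro ⟨γ₀, hγ₀, r, -, hrb, hR⟩
    exact lt_of_le_of_lt ((EriceRemainderEnclosureDiagonal.remainderConst_iff_le hβ hM.le S hS hγ₀).mp hR) hrb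
  · exact ⟨1, one_pos, M, hM.le, hb,
      (EriceRemainderEnclosureDiagonal.remainderConst_iff_le hβ hM.le S hS one_pos).mpr le_rfl⟩

/-- On EVERY box `γ > 0` the oscillation of the (D4-J3) perturbation `β k p = −βE k (p_k²) + M·h(p_k ∕ p_0)` (`M > 0`, ANY Markov datum
`βE`) reaches `M` — the two-level history `(γ, γ, …, γ∕2)` against its diagonal ((D4-J3) `osc_twoLevel`); so no oscillation bound `< M`
holds on any box. [folklore] -/
theorem not_osc_lt_historyBlind {βE : ℕ → ℝ → ℝ} {M : ℝ}
    (hβ : ∀ (k : ℕ) (p : Fin (k + 1) → ℝ), β k p =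
      -(βE k (p (Fin.last k) ^ 2)) + M * max 0 (min 1 (4 * (p (Fin.last k) / p 0) * (1 - p (Fin.last k) / p 0))))
    (hM : 0 < M) {γ : ℝ} (hγ : 0 < γ)
    (hall : ∀ (k : ℕ) (p : Fin (k + 1) → ℝ), p ∈ B12Beta.HistBox γ k →
      |β k p - β k (fun _ : Fin (k + 1) => p (Fin.last k))| < M) : False := by
  have ht : (0 : ℝ) < γ / 2 := by positivity
  have htγ : 2 * (γ / 2) ≤ γ := by linarith
  have h := hall (0 + 1) _ (EriceRemainderEnclosureHistoryBlind.twoLevel_mem_histBox ht htγ 0)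
  rw [twoLevel_last, EriceRemainderEnclosureHistoryBlind.osc_twoLevel hβ ht.ne' 0, abs_of_pos hM] at h
  exact lt_irrefl M h

/-- **§1's FACTOR 2 IS SHARP** — the (D4-J3) perturbation `β k p = −βE k (p_k²) + M·h(p_k ∕ p_0)` of the JUMP datum
`βE k t = (M∕2)·[t ≠ 0]` (`M > 0`; road P3's §4 of `RemainderExplicitHistoryJunction`): every split has remainder constant exactly
`M∕2` on every box, so CONSUMED(b) ⟺ `M∕2 < b`; yet on EVERY box `γ > 0` the oscillation reaches `M` (the two-level history
`(γ, γ, …, γ∕2)` against its diagonal) — no oscillation bound `< M = 2·(M∕2)` holds on any box.  So «oscillation `< 2b`» in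
`boundedInputs_of_consumed` cannot be sharpened. [folklore] -/
theorem necessity_factor_two_attained {M : ℝ} (hM : 0 < M) :
    ∃ (β : HBeta) (S : B12Beta.OneLoopSplit β),
      (∀ b : ℝ, (∃ γ₀ : ℝ, 0 < γ₀ ∧ ∃ r : ℝ, 0 ≤ r ∧ r < b ∧ RemainderConst S γ₀ r) ↔ M / 2 < b) ∧
      ∀ γ : ℝ, 0 < γ → ¬ ∀ (k : ℕ) (p : Fin (k + 1) → ℝ), p ∈ B12Beta.HistBox γ k →
        |β k p - β k (fun _ : Fin (k + 1) => p (Fin.last k))| < M := by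
  have hβ : ∀ (k : ℕ) (p : Fin (k + 1) → ℝ),
      (fun (k : ℕ) (p : Fin (k + 1) → ℝ) =>
        -((fun (_ : ℕ) (t : ℝ) => if t = 0 then (0 : ℝ) else M / 2) k (p (Fin.last k) ^ 2)) +
          M * max 0 (min 1 (4 * (p (Fin.last k) / p 0) * (1 - p (Fin.last k) / p 0)))) k p =
      -((fun (_ : ℕ) (t : ℝ) => if t = 0 then (0 : ℝ) else M / 2) k (p (Fin.last k) ^ 2)) +
        M * max 0 (min 1 (4 * (p (Fin.last k) / p 0) * (1 - p (Fin.last k) / p 0))) :=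
    fun _ _ => rfl
  have h0 : ∀ n, (fun (_ : ℕ) (t : ℝ) => if t = 0 then (0 : ℝ) else M / 2) n 0 = (fun _ : ℕ => (0 : ℝ)) n :=
    fun n => by simp
  have hE : ∀ (k : ℕ) (t : ℝ), t ≠ 0 →
      (fun (_ : ℕ) (t : ℝ) => if t = 0 then (0 : ℝ) else M / 2) k t = (fun _ : ℕ => (0 : ℝ)) k + M / 2 :=
    fun k t ht => by simp [ht]
  obtain ⟨S, hS⟩ := EriceRemainderEnclosureHistoryBlind.exists_split
    (βE := fun (_ : ℕ) (t : ℝ) => if t = 0 then (0 : ℝ) else M / 2) (β₀seq := fun _ : ℕ => (0 : ℝ)) (M := M) hβ h0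
  refine ⟨_, S, fun b => ⟨?_, fun hb => ?_⟩, fun γ hγ hall =>
    not_osc_lt_historyBlind (βE := fun (_ : ℕ) (t : ℝ) => if t = 0 then (0 : ℝ) else M / 2) (M := M) hβ hM hγ hall⟩
  · rintro ⟨γ₀, hγ₀, r, -, hrb, hR⟩
    exact lt_of_le_of_lt ((remainderConst_jump_iff hβ h0 hE hM.le S hγ₀).mp hR) hrb
  · exact ⟨1, one_pos, M / 2, by positivity, hb, remainderConst_jump hβ h0 hE hM.le S 1⟩

/-! ## §4 Road P3's END in the consumed currency -/

variable (Lc : ℕ) [NeZero Lc] (Mc : ℕ) [NeZero Mc] (Nn : ℕ → ℕ) [∀ n, NeZero (Nn n)]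

/-- [folklore] **ROAD P3 EXITS IN THE CONSUMED SHAPE WITH THE BOUNDED INPUTS `(r⋆, 2r⋆)`.**  With road P3's END constants `(δ₀⋆, B₃)`
(`RemainderExplicitEnd.exists_remainderConst_of_residualChain`): for EVERY β-family, split `S`, residual printed input (R) relative to the
explicit carrier family on a box `γ > 0` and the numeric conditions, writing `r⋆ := c.ε₁ · remCoeffL 4 Mc c α₂ B₃`: CONSUMED(b) for
every `b > r⋆` (γ₀ = γ, r = r⋆ — ONE γ-independent constant, NO modulus), BOUNDED DIAGONAL(γ, r⋆) and BOUNDED OSCILLATION(γ, 2r⋆).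
Nothing of Bałaban's asserted; THE INSTANCE (a residual chain for Bałaban's objects) is 0∕1. -/
theorem roadP3_consumed (hN : Tendsto Nn atTop atTop) (μ ν : Fin 4) :
    ∃ δ₀ B₃ : ℝ, 0 < δ₀ ∧ 0 ≤ B₃ ∧
      ∀ {β : HBeta} {S : B12Beta.OneLoopSplit β} {γ : ℝ} {c : B13.Consts} {ℓ α₂ : ℝ}
        (_R : ResidualChain 4 Mc μ ν S γ c ℓ α₂ (carrierFamily Lc Mc Nn hN μ ν)),
        CondsL 4 c ℓ → c.R22gen ℓ → 0 ≤ c.C3act * c.ε₁ → 0 < α₂ → 0 < c.δ₀ → c.δ₀ ≤ δ₀ → 0 < γ →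
          (∀ b : ℝ, c.ε₁ * remCoeffL 4 Mc c α₂ B₃ < b →
            ∃ γ₀ : ℝ, 0 < γ₀ ∧ ∃ r : ℝ, 0 ≤ r ∧ r < b ∧ RemainderConst S γ₀ r) ∧
          (∀ (k : ℕ) (g : ℝ), 0 < g → g ≤ γ →
            |S.β1 k (fun _ : Fin (k + 1) => g)| ≤ c.ε₁ * remCoeffL 4 Mc c α₂ B₃) ∧
          (∀ (k : ℕ) (p : Fin (k + 1) → ℝ), p ∈ B12Beta.HistBox γ k →
            |β k p - β k (fun _ : Fin (k + 1) => p (Fin.last k))| ≤ 2 * (c.ε₁ * remCoeffL 4 Mc c α₂ B₃)) := by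
  obtain ⟨δ₀, B₃, hδ, hB, hEND⟩ := exists_remainderConst_of_residualChain Lc Mc Nn hN μ ν
  refine ⟨δ₀, B₃, hδ, hB, ?_⟩
  intro β S γ c ℓ α₂ R hC h22 hA hα₂ hδpos hδle hγ
  have h := hEND R hC h22 hA hα₂ hδpos hδle
  exact ⟨fun b hb => ⟨γ, hγ, _, remainderConst_nonneg S hγ h, hb, h⟩,
    fun k _ hg hgγ => diag_le_of_remainderConst S h k hg hgγ, fun k _ hp => osc_le_of_remainderConst S h k hp⟩

/-! ## END -/

/-- **END — THE JUNCTION INPUTS IN THE CONSUMED CURRENCY.**  (a) NECESSITY: CONSUMED(b) ⟹ bounded diagonal remainder `r` and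
bounded oscillation `2r`, `r < b`, on its box; (b) SUFFICIENCY: bounded inputs `d`, `o` on a box `γ > 0` with `d + o < b` ⟹ CONSUMED(b);
(c) `d + o < b` is attained (CONSUMED fails at `b = d + o` for (E11)'s family, d = 0, o = M); (d) the factor 2 of (a) is attained (the
(D4-J3) perturbation of the jump datum: CONSUMED(b) ⟺ M∕2 < b, no oscillation bound below M on any box).  READING: for (D4) AS
CONSUMED at the drift's b the junction inputs are due in BOUNDED form on ONE box (diagonal `< b`, oscillation `< 2b`), not as moduli at
g² = 0 (those price the JUNCTION route, (D4-J2)∕(D4-J4)); road P3's (R) at small ε₁ supplies `(r⋆, 2r⋆)` (§4), given THE INSTANCE (0∕1).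
Nothing of Bałaban's; class UNCHANGED. [cite: Balaban1987RG1, (1.22) p.264 and (2.12)–(2.14) p.268 — shapes only, nothing asserted] -/
theorem consumedShape_census :
    (∀ (β : HBeta) (S : B12Beta.OneLoopSplit β) (b : ℝ),
      (∃ γ₀ : ℝ, 0 < γ₀ ∧ ∃ r : ℝ, 0 ≤ r ∧ r < b ∧ RemainderConst S γ₀ r) →
      ∃ γ₀ : ℝ, 0 < γ₀ ∧ ∃ r : ℝ, 0 ≤ r ∧ r < b ∧
        (∀ (k : ℕ) (g : ℝ), 0 < g → g ≤ γ₀ → |S.β1 k (fun _ : Fin (k + 1) => g)| ≤ r) ∧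
        (∀ (k : ℕ) (p : Fin (k + 1) → ℝ), p ∈ B12Beta.HistBox γ₀ k →
          |β k p - β k (fun _ : Fin (k + 1) => p (Fin.last k))| ≤ 2 * r)) ∧
    (∀ (β : HBeta) (S : B12Beta.OneLoopSplit β) (γ d o b : ℝ), 0 < γ →
      (∀ (k : ℕ) (g : ℝ), 0 < g → g ≤ γ → |S.β1 k (fun _ : Fin (k + 1) => g)| ≤ d) →
      (∀ (k : ℕ) (p : Fin (k + 1) → ℝ), p ∈ B12Beta.HistBox γ k →
        |β k p - β k (fun _ : Fin (k + 1) => p (Fin.last k))| ≤ o) →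
      d + o < b → ∃ γ₀ : ℝ, 0 < γ₀ ∧ ∃ r : ℝ, 0 ≤ r ∧ r < b ∧ RemainderConst S γ₀ r) ∧
    (∀ M : ℝ, 0 < M → ∃ (β : HBeta) (S : B12Beta.OneLoopSplit β),
      (∀ (k : ℕ) (g : ℝ), S.β1 k (fun _ : Fin (k + 1) => g) = 0) ∧
      (∀ (γ : ℝ) (k : ℕ) (p : Fin (k + 1) → ℝ), p ∈ B12Beta.HistBox γ k →
        |β k p - β k (fun _ : Fin (k + 1) => p (Fin.last k))| ≤ M) ∧
      ¬ ∃ γ₀ : ℝ, 0 < γ₀ ∧ ∃ r : ℝ, 0 ≤ r ∧ r < M ∧ RemainderConst S γ₀ r) ∧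
    (∀ M : ℝ, 0 < M → ∃ (β : HBeta) (S : B12Beta.OneLoopSplit β),
      (∀ b : ℝ, M / 2 < b → ∃ γ₀ : ℝ, 0 < γ₀ ∧ ∃ r : ℝ, 0 ≤ r ∧ r < b ∧ RemainderConst S γ₀ r) ∧
      ∀ γ : ℝ, 0 < γ → ¬ ∀ (k : ℕ) (p : Fin (k + 1) → ℝ), p ∈ B12Beta.HistBox γ k →
        |β k p - β k (fun _ : Fin (k + 1) => p (Fin.last k))| < M) :=
  ⟨fun _ S _ hC => boundedInputs_of_consumed S hC,
    fun _ S _ _ _ _ hγ hd ho hb => consumed_of_diag_osc S hγ hd ho hb,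
    fun M hM => by
      obtain ⟨β, S, h1, h2, h3⟩ := sufficiency_threshold_attained hM
      exact ⟨β, S, h1, h2, fun h => lt_irrefl M ((h3 M).mp h)⟩,
    fun M hM => by
      obtain ⟨β, S, h1, h2⟩ := necessity_factor_two_attained hM
      exact ⟨β, S, fun b hb => (h1 b).mpr hb, h2⟩⟩

end Summit.QuantumFields.BalabanUV.Beta.RemainderExplicitConsumedShape

end
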